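import Summits.Ventures.CertifiedManyBodySolver.Observables.CanonicalCeilingW32K4o7SourcedRowG6o7
import HarnessLib

/-!
# Three more E15-anchored t′ = 0 canonical response ceiling slots on the κ 4/7 HEAD cap line (xh): g ∈ {3/28, 1/7, 5/28}
# (companion of `Observables/CanonicalCeilingW32K4o7SourcedRowG6o7.lean` §3, same premises; separate small module because that file sits at its size limit)

Cell hubbard-floor (D-0160 FLOOR cell FQ1(a); seat hubbard-floor-eng-1 g2, 2026-08-28). The head-line ceiling
`canonicalCeiling_n7o8_tp0_W32k4o7xh_of_row_g6o7` (p673017; valid `0 < g ≤ 2/7`; cap = W5 κ 4/7 two-field node read DOWN from `g₀ = 2/7` ⊕ x2dk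
`cert_capTPx2dk_4x3_U8_tpm1o4_g3o14_mu5o2`; anchor = the FLOOR cell's S1 row E15 @ g₂ = 6/7) rounded UP to 7 dp at the three FLOOR-cell grid fields BELOW
the cq grid — **3/28 ↦ Re ω(P₀^d) ≤ 0.8736342 @ h_tree 0.15152 · 1/7 ↦ ≤ 0.8903954 @ 0.20203 · 5/28 ↦ ≤ 0.9089209 @ 0.25254** (exact x = 0.8736341733…,
0.8903953572…, 0.9089208763…) — tighter than the cluster-line slots of record there (0.8868506 / 0.9136140 / 0.9414397) and closing the ceiling column
monotonically below 0.26517 (0.8736342 < 0.8903954 < 0.9089209 < 0.9138611 < …).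

SIZE, STATED PLAINLY: kinematic scale; no floor exists at these fields (cells are one-sided); CONSISTENT WITH ANY RESPONSE SHAPE below that scale,
`m ≤ C·h` included. HONEST FRAMING: finite-field RESPONSE ceilings at large pairing fields (h_p = 4·h_tree) on infinite-volume ground states at fixed
density ⅞, CONDITIONAL by name on the κ 4/7 two-field node (W5-CERTIFIED), the x2dk head cap node (refereed) and the S1 row (dual certificate replayed);
«m(h) ≤ m⁺ at h = …, CERTIFIED(KERNEL) modulo the nodes, class A0′ = (8, ⅞, 0)» — a ceiling never speaks to presence; nothing about `h → 0`; never onset,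
gap, Tc or order; superconductivity in the Hubbard model is NOT proved or disproved by any of this. Zero compute; no definition; no named fact; no `sorry`.
References: R. B. Griffiths, Phys. Rev. 152 (1966) 240 §II; T. Koma, H. Tasaki, J. Stat. Phys. 76 (1994) 745 §1.
-/

noncomputable section

namespace Summit.Ventures.CertifiedManyBodySolver.Observables

open Matrix Finset Literature.Probability.LatticeModels
open Literature.MathematicalPhysics.QuantumLattice Literature.MathematicalPhysics.QuantumLattice.ThermodynamicLimit
open Literature.MathematicalPhysics.QuantumLattice.TwoCluster InfVolFermionState
open Summit.Ventures.CertifiedManyBodySolver Summit.Ventures.CertifiedManyBodySolver.Certificates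
open scoped ComplexOrder

section SlotsLow

variable {ω : InfVolFermionState 2}

/-- `1.4142135623 < √2`. [folklore] -/
private theorem sqrt_two_gt_14142135623 : (14142135623 / 10 ^ 10 : ℝ) < Real.sqrt 2 := by
  rw [Real.lt_sqrt (by norm_num)]; norm_num

/-- Slot rule for a ceiling: from `x ≤ N/(2(√2·g₂ − √2·g))` with `g < g₂`, `0 ≤ N` and the decidable side condition
`N·10¹⁰ ≤ M·2·14142135623·(g₂ − g)` conclude `x ≤ M`. [folklore] -/
private theorem chord_le_of_decimal_bound {x N g g₂ M : ℝ} (hgg : g < g₂) (hN : 0 ≤ N)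
    (hside : N * 10 ^ 10 ≤ M * (2 * 14142135623 * (g₂ - g))) (hx : x ≤ N / (2 * (Real.sqrt 2 * g₂ - Real.sqrt 2 * g))) : x ≤ M := by
  have hs := sqrt_two_gt_14142135623
  have hδ : 0 < g₂ - g := sub_pos.2 hgg
  have hden : 0 < 2 * (Real.sqrt 2 * g₂ - Real.sqrt 2 * g) := by
    have : Real.sqrt 2 * g₂ - Real.sqrt 2 * g = Real.sqrt 2 * (g₂ - g) := by ring
    rw [this]; positivity
  refine hx.trans ?_
  rw [div_le_iff₀ hden]
  have hM : 0 ≤ M := by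
    by_contra hM'
    have : M * (2 * 14142135623 * (g₂ - g)) < 0 := mul_neg_of_neg_of_pos (not_le.mp hM') (by positivity)
    nlinarith
  nlinarith [mul_le_mul_of_nonneg_left hs.le (by positivity : (0:ℝ) ≤ M * (2 * (g₂ - g)))]

/-- **Ceiling slot at `g = 3/28` (`h_tree ≈ 0.15152`), xh line vs the `6/7` row: `Re ω(P₀^d) ≤ 0.8736342`** for every translation-invariant
density-`7/8` minimiser of `E_{√2·3/28}` (exact chord 0.8736341733…, 7 dp UP; cluster-line slot of record 0.8868506). CONDITIONAL on the κ 4/7 two-field node +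
`cert_capTPx2dk_4x3_U8_tpm1o4_g3o14_mu5o2` + `cert_pin1menuA0p_L3h0_U8_tp0_g6o7_E_j313009`. Kinematic scale; never speaks to presence. [cite: Griffiths1966, §II] -/
theorem canonicalCeiling_n7o8_tp0_W32k4o7xh_decimal_g3o28_r6o7 (hω : ω.IsTranslationInvariant) (hρ : ω.density = 7 / 8)
    (hmin : ∀ ω' : InfVolFermionState 2, ω'.IsTranslationInvariant → ω'.density = 7 / 8 →
      ω.meanEnergy (hubbardTTPrimeSourcedInteraction 1 0 8 0 dWaveFormFactor (Real.sqrt 2 * (3 / 28 : ℝ))) 1 ≤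
        ω'.meanEnergy (hubbardTTPrimeSourcedInteraction 1 0 8 0 dWaveFormFactor (Real.sqrt 2 * (3 / 28 : ℝ))) 1)
    (hW : cert_sgf_openbox32x4_U8_mu7o4_k4o7_j264563_twoField) (hC : cert_capTPx2dk_4x3_U8_tpm1o4_g3o14_mu5o2) (hN : cert_pin1menuA0p_L3h0_U8_tp0_g6o7_E_j313009) :
    (ω.expect (pairRegion (insert (0 : Site 2) unitSteps) 0) (localPairAt (insert 0 unitSteps) dWaveFormFactor 0)).re ≤ (8736342 / 10000000 : ℝ) :=
  chord_le_of_decimal_bound (by norm_num) (by push_cast; norm_num) (by push_cast; norm_num)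
    (canonicalCeiling_n7o8_tp0_W32k4o7xh_of_row_g6o7 (3 / 28 : ℝ) (by norm_num) (by norm_num) hω hρ hmin hW hC hN)

/-- **Ceiling slot at `g = 1/7` (`h_tree ≈ 0.20203`), xh line vs the `6/7` row: `Re ω(P₀^d) ≤ 0.8903954`** for every translation-invariant
density-`7/8` minimiser of `E_{√2·1/7}` (exact chord 0.8903953572…, 7 dp UP; cluster-line slot of record 0.9136140). CONDITIONAL on the κ 4/7 two-field node +
`cert_capTPx2dk_4x3_U8_tpm1o4_g3o14_mu5o2` + `cert_pin1menuA0p_L3h0_U8_tp0_g6o7_E_j313009`. Kinematic scale; never speaks to presence. [cite: Griffiths1966, §II] -/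
theorem canonicalCeiling_n7o8_tp0_W32k4o7xh_decimal_g1o7_r6o7 (hω : ω.IsTranslationInvariant) (hρ : ω.density = 7 / 8)
    (hmin : ∀ ω' : InfVolFermionState 2, ω'.IsTranslationInvariant → ω'.density = 7 / 8 →
      ω.meanEnergy (hubbardTTPrimeSourcedInteraction 1 0 8 0 dWaveFormFactor (Real.sqrt 2 * (1 / 7 : ℝ))) 1 ≤
        ω'.meanEnergy (hubbardTTPrimeSourcedInteraction 1 0 8 0 dWaveFormFactor (Real.sqrt 2 * (1 / 7 : ℝ))) 1)
    (hW : cert_sgf_openbox32x4_U8_mu7o4_k4o7_j264563_twoField) (hC : cert_capTPx2dk_4x3_U8_tpm1o4_g3o14_mu5o2) (hN : cert_pin1menuA0p_L3h0_U8_tp0_g6o7_E_j313009) :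
    (ω.expect (pairRegion (insert (0 : Site 2) unitSteps) 0) (localPairAt (insert 0 unitSteps) dWaveFormFactor 0)).re ≤ (8903954 / 10000000 : ℝ) :=
  chord_le_of_decimal_bound (by norm_num) (by push_cast; norm_num) (by push_cast; norm_num)
    (canonicalCeiling_n7o8_tp0_W32k4o7xh_of_row_g6o7 (1 / 7 : ℝ) (by norm_num) (by norm_num) hω hρ hmin hW hC hN)

/-- **Ceiling slot at `g = 5/28` (`h_tree ≈ 0.25254`), xh line vs the `6/7` row: `Re ω(P₀^d) ≤ 0.9089209`** for every translation-invariant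
density-`7/8` minimiser of `E_{√2·5/28}` (exact chord 0.9089208763…, 7 dp UP; cluster-line slot of record 0.9414397). CONDITIONAL on the κ 4/7 two-field node +
`cert_capTPx2dk_4x3_U8_tpm1o4_g3o14_mu5o2` + `cert_pin1menuA0p_L3h0_U8_tp0_g6o7_E_j313009`. Kinematic scale; never speaks to presence. [cite: Griffiths1966, §II] -/
theorem canonicalCeiling_n7o8_tp0_W32k4o7xh_decimal_g5o28_r6o7 (hω : ω.IsTranslationInvariant) (hρ : ω.density = 7 / 8)
    (hmin : ∀ ω' : InfVolFermionState 2, ω'.IsTranslationInvariant → ω'.density = 7 / 8 →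
      ω.meanEnergy (hubbardTTPrimeSourcedInteraction 1 0 8 0 dWaveFormFactor (Real.sqrt 2 * (5 / 28 : ℝ))) 1 ≤
        ω'.meanEnergy (hubbardTTPrimeSourcedInteraction 1 0 8 0 dWaveFormFactor (Real.sqrt 2 * (5 / 28 : ℝ))) 1)
    (hW : cert_sgf_openbox32x4_U8_mu7o4_k4o7_j264563_twoField) (hC : cert_capTPx2dk_4x3_U8_tpm1o4_g3o14_mu5o2) (hN : cert_pin1menuA0p_L3h0_U8_tp0_g6o7_E_j313009) :
    (ω.expect (pairRegion (insert (0 : Site 2) unitSteps) 0) (localPairAt (insert 0 unitSteps) dWaveFormFactor 0)).re ≤ (9089209 / 10000000 : ℝ) :=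
  chord_le_of_decimal_bound (by norm_num) (by push_cast; norm_num) (by push_cast; norm_num)
    (canonicalCeiling_n7o8_tp0_W32k4o7xh_of_row_g6o7 (5 / 28 : ℝ) (by norm_num) (by norm_num) hω hρ hmin hW hC hN)

end SlotsLow

end Summit.Ventures.CertifiedManyBodySolver.Observables

end
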